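import Literature.AlgebraicGeometry.GroupSchemes.RelativeFrobeniusOverBase
import Literature.AlgebraicGeometry.GroupSchemes.GroupSchemeKernel
import Literature.AlgebraicGeometry.Motives.AbelianVarietyFrobeniusTwist
import HarnessLib

/-!
# The kernel `Ker F_{G/S}` of the relative Frobenius of a group scheme over an `𝔽_q`-base (SGA 3 VII_A §4)

Topic `AlgebraicGeometry/GroupSchemes`; namespace `Literature.AlgebraicGeometry.GroupSchemes.RelFrobenius` (continues ★
`RelativeFrobeniusOverBase`).  DEFINITIONS WITH BODIES (two `abbrev`s and one `def` over ★ `GroupSchemeKernel`) and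
fully proved theorems: **no named fact, no `sorry`, no instance, no notation**.  Cell `pub/hodgecm-mathlib`, programme
P6 («MOD»), organ (O3) of the P6c census («`ker(F_q | 𝒢̄) ∩ Ḡ`», `secFrob` as a morphism), file (O3b).

## Mathematics

Let `S` be a scheme over the finite field `k = 𝔽_q`, `G → S` an `S`-group scheme and `F_{G/S} : G → G^{(q/S)}` its
relative `q`-Frobenius, a homomorphism of `S`-group schemes (★ `isMonHom_relFrobenius`).  Its KERNEL
`Ker F_{G/S} := G ×_{G^{(q/S)}, e} S` [SGA3 VII_A 4.1∕4.3; Görtz–Wedhorn Def. 4.45 (2)] is an `S`-group scheme with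
a monomorphic homomorphism `ι : Ker F_{G/S} → G`, a CLOSED subgroup scheme when `G → S` is separated.  On
`T`-valued points (`T → S`): a point `g ∈ G(T)` satisfies `F_{G/S}(g) = 1` iff `F_T ≫ g = F_T ≫ 1` (the absolute
`q`-Frobenius of `T` followed by `g`, resp. by the unit), because both sides of `F_{G/S}(g) = 1` are determined by
their projection to `G`, which are `F_T ≫ g` and `(T → S) ≫ F_S ≫ e = F_T ≫ (T → S) ≫ e`.  Consequences: for a
REDUCED `T` the absolute Frobenius `F_T` is an epimorphism (★ `epi_powEndo`), so `Ker F_{G/S}(T) = {1}` («the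
Frobenius kernel is infinitesimal»); and every point of the underlying space of `Ker F_{G/S}` lies on the unit section
of `G`.

## Contents (`k` finite, `S : SchemeOver k`, `G : Over S.left` with `[GrpObj G]`, `open scoped CategoryTheory.Obj`)
* §1 `one_left_comp_twistFst` (the unit of `G^{(q/S)}` projects to `F_S ≫ e_G`), **`comp_relFrobenius_eq_one_iff`**
  (`g ≫ F_{G/S} = 1 ↔ F_T ≫ g.left = F_T ≫ (1 : T ⟶ G).left`), `eq_one_of_comp_relFrobenius_eq_one` (`T` reduced).
* §2 **`frobKernel S G`** (`abbrev` for ★ `GroupSchemeKernel.ker (relFrobenius S G)`; group structure and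
  `IsMonHom` of the inclusion are ★ `GroupSchemeKernel.grpObjKer`∕`isMonHom_kerι`), `frobKernelι`,
  `frobKernelι_comp_relFrobenius`, `absFrob_comp_frobKernelι` (points of the kernel satisfy the Frobenius condition),
  `frobKernelLift`∕`frobKernelLift_ι` (universal property in the `F_T`-form), **`comp_frobKernelι_eq_one`**
  (`Ker F_{G/S}(T) = 1` for `T` reduced), `isSeparated_frobTwist_hom`,
  **`isClosedImmersion_frobKernelι_left`** (`G → S` separated), **`frobKernelι_left_apply_mem_range`** (the
  underlying points of `Ker F_{G/S}` lie on the unit section).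

What is deliberately NOT here: finiteness∕flatness∕rank of `Ker F_{G/S} → S` (for `G` an abelian scheme of relative
dimension `g`: finite locally free of rank `q^g`, SGA3 VII_A 4.3 — file (O3c)), base change of the kernel along
`S′ → S`, the Verschiebung.  HC_CM is proved only modulo the printed citations until rung 0 closes; no count changes.

## References
* [SGA3I] SGA 3, Tome I, Exp. VII_A (P. Gabriel), §4 (Frobenius, `F_{X/S}`, `_F G := Ker F_{G/S}`), 4.1–4.3.
* [GortzWedhorn2020] U. Görtz, T. Wedhorn, *Algebraic Geometry I* (2nd ed.), Definition 4.45 (2) p. 117 (kernel of a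
  homomorphism of group schemes), Def. 4.24 (Frobenius), Exercise 4.25 (Frobenius of a reduced scheme).
-/

set_option autoImplicit false

noncomputable section

-- Compositions through `((Over.pullback f).obj X).left = pullback X.hom f` and `(𝟙_ (Over S)).left = S` are
-- definitional only above `instances` transparency (as in Mathlib's `CategoryTheory.Over.pullback` API and ★
-- `RelativeFrobeniusOverBase`).
set_option backward.isDefEq.respectTransparency false

universe u

open CategoryTheory CategoryTheory.Limits AlgebraicGeometry MonoidalCategory CartesianMonoidalCategory

namespace Literature.AlgebraicGeometry.GroupSchemes.RelFrobenius

open Literature.AlgebraicGeometry.Motives GroupSchemeKernel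
open scoped MonObj Obj

variable {k : Type u} [Field k] [Finite k] (S : SchemeOver k) (G : Over S.left) [GrpObj G]

/-! ## §1 When is `F_{G/S}(g) = 1`? -/

section Criterion

/-- The unit section of the twist `G^{(q/S)}` (base change of `e_G`) projects to `F_S ≫ e_G`:
`e_{G^{(q/S)}} ≫ pr_G = F_S ≫ e_G`. [cite: SGA3I, VII_A 4.1] -/
@[reassoc]
theorem one_twist_left_comp_twistFst :
    (η[frobTwist S G] : 𝟙_ (Over S.left) ⟶ frobTwist S G).left ≫ twistFst S G =
      (frobeniusOver S).left ≫ (η[G] : 𝟙_ (Over S.left) ⟶ G).left := by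
  rw [← one_comp_relFrobenius, comp_relFrobenius_left_comp_twistFst, absFrob_tensorUnit]

variable {G} in
/-- For a `T`-valued point, the trivial point `1 : T ⟶ G^{(q/S)}` projects to `(T → S) ≫ F_S ≫ e_G = F_T ≫ 1_G(T)`.
[cite: SGA3I, VII_A 4.1] -/
@[reassoc]
theorem one_left_comp_twistFst (T : Over S.left) :
    (1 : T ⟶ frobTwist S G).left ≫ twistFst S G = absFrob S T ≫ (1 : T ⟶ G).left := by
  rw [Hom.one_def, Hom.one_def, Over.comp_left, Over.comp_left, Category.assoc,
    one_twist_left_comp_twistFst, Over.toUnit_left, ← absFrob_comp_hom_assoc]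

variable {G} in
/-- **`F_{G/S}(g) = 1` iff `F_T ≫ g = F_T ≫ 1`**: a `T`-valued point `g ∈ G(T)` is killed by the relative Frobenius iff
`g` and the unit agree after PRE-composition with the absolute `q`-Frobenius `F_T` of `T` (both `F_{G/S}(g)` and `1`
are determined by their projections to `G`, which are `F_T ≫ g` and `F_T ≫ 1`). [cite: SGA3I, VII_A 4.1] -/
theorem comp_relFrobenius_eq_one_iff {T : Over S.left} (g : T ⟶ G) :
    g ≫ relFrobenius S G = 1 ↔ absFrob S T ≫ g.left = absFrob S T ≫ (1 : T ⟶ G).left := by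
  constructor
  · intro h
    rw [← comp_relFrobenius_left_comp_twistFst, h, one_left_comp_twistFst]
  · intro h
    exact frobTwist_hom_ext S (by rw [comp_relFrobenius_left_comp_twistFst, h, one_left_comp_twistFst])

variable {G} in
/-- Over a REDUCED `T`, `F_{G/S}(g) = 1` forces `g = 1`: the absolute Frobenius of a reduced scheme is an epimorphism
(★ `epi_powEndo`, Görtz–Wedhorn Exercise 4.25), so it cancels in `F_T ≫ g = F_T ≫ 1`.
[cite: GortzWedhorn2020, Exercise 4.25] -/
theorem eq_one_of_comp_relFrobenius_eq_one {T : Over S.left} [IsReduced T.left] (g : T ⟶ G)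
    (h : g ≫ relFrobenius S G = 1) : g = 1 := by
  haveI : Epi (absFrob S T) := epi_powEndo T.left _ _ _
  ext : 1
  exact (cancel_epi (absFrob S T)).mp ((comp_relFrobenius_eq_one_iff S g).mp h)

end Criterion

/-! ## §2 The kernel `Ker F_{G/S}` -/

section Kernel

/-- **The Frobenius kernel `Ker F_{G/S} = G ×_{G^{(q/S)}, e} S`** of an `S`-group scheme over an `𝔽_q`-scheme `S`:
the kernel (★ `GroupSchemeKernel.ker`, Görtz–Wedhorn Def. 4.45 (2)) of the homomorphism `F_{G/S} : G → G^{(q/S)}`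
(★ `isMonHom_relFrobenius`).  It is an `S`-group scheme and its inclusion is a monomorphic homomorphism by ★
`GroupSchemeKernel.grpObjKer`, `mono_kerι`, `isMonHom_kerι` (instances∕theorems of that file, available on this
`abbrev` by unification). [cite: SGA3I, VII_A 4.1] -/
abbrev frobKernel : Over S.left := ker (relFrobenius S G)

/-- The inclusion `ι : Ker F_{G/S} ⟶ G`. [cite: SGA3I, VII_A 4.1] -/
abbrev frobKernelι : frobKernel S G ⟶ G := kerι (relFrobenius S G)

/-- `ι ≫ F_{G/S} = 1`. [cite: GortzWedhorn2020, Definition 4.45 (2), p. 117] -/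
theorem frobKernelι_comp_relFrobenius : frobKernelι S G ≫ relFrobenius S G = 1 :=
  kerι_comp (relFrobenius S G)

variable {G}

/-- A `T`-valued point of `Ker F_{G/S}`, read in `G`, satisfies the Frobenius condition `F_T ≫ g = F_T ≫ 1`.
[cite: SGA3I, VII_A 4.1] -/
theorem absFrob_comp_frobKernelι {T : Over S.left} (κ : T ⟶ frobKernel S G) :
    absFrob S T ≫ (κ ≫ frobKernelι S G).left = absFrob S T ≫ (1 : T ⟶ G).left :=
  (comp_relFrobenius_eq_one_iff S (κ ≫ frobKernelι S G)).mp
    (by rw [Category.assoc, frobKernelι_comp_relFrobenius, MonObj.comp_one])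

/-- **The universal property of `Ker F_{G/S}` in Frobenius form**: a point `g ∈ G(T)` with `F_T ≫ g = F_T ≫ 1` factors
through the kernel. [cite: GortzWedhorn2020, Definition 4.45 (2), p. 117] -/
def frobKernelLift {T : Over S.left} (g : T ⟶ G) (hg : absFrob S T ≫ g.left = absFrob S T ≫ (1 : T ⟶ G).left) :
    T ⟶ frobKernel S G :=
  kerLift g ((comp_relFrobenius_eq_one_iff S g).mpr hg)

/-- `frobKernelLift g _ ≫ ι = g`. [cite: GortzWedhorn2020, Definition 4.45 (2), p. 117] -/
@[reassoc (attr := simp)]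
theorem frobKernelLift_ι {T : Over S.left} (g : T ⟶ G) (hg : absFrob S T ≫ g.left = absFrob S T ≫ (1 : T ⟶ G).left) :
    frobKernelLift S g hg ≫ frobKernelι S G = g :=
  kerLift_ι g _

/-- **The Frobenius kernel is infinitesimal: it has only the trivial point with values in any REDUCED `S`-scheme**,
`Ker F_{G/S}(T) = {1}` for `T` reduced. [cite: SGA3I, VII_A 4.1] -/
theorem comp_frobKernelι_eq_one {T : Over S.left} [IsReduced T.left] (κ : T ⟶ frobKernel S G) :
    κ ≫ frobKernelι S G = 1 :=
  eq_one_of_comp_relFrobenius_eq_one S (κ ≫ frobKernelι S G)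
    (by rw [Category.assoc, frobKernelι_comp_relFrobenius, MonObj.comp_one])

/-- Two points of the Frobenius kernel with values in a reduced `S`-scheme coincide. [cite: SGA3I, VII_A 4.1] -/
theorem frobKernel_hom_eq_of_isReduced {T : Over S.left} [IsReduced T.left] (κ κ' : T ⟶ frobKernel S G) : κ = κ' :=
  ker_hom_ext (by rw [comp_frobKernelι_eq_one, comp_frobKernelι_eq_one])

variable (G)

omit [GrpObj G] in
/-- The structure map of the twist `G^{(q/S)} → S` is separated when `G → S` is (base change).
[cite: GortzWedhorn2020, Section (4.7)] -/
theorem isSeparated_frobTwist_hom [IsSeparated G.hom] : IsSeparated (frobTwist S G).hom := by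
  rw [frobTwist_hom]
  infer_instance

/-- **`Ker F_{G/S} → G` is a closed immersion** when `G → S` is separated (the unit section of the separated
`S`-group scheme `G^{(q/S)}` is a closed immersion, ★ `GroupSchemeKernel.isClosedImmersion_kerι_left_of_isSeparated`):
the Frobenius kernel is a closed subgroup scheme of `G`. [cite: GortzWedhorn2020, Definition 4.45 (2), p. 117] -/
theorem isClosedImmersion_frobKernelι_left [IsSeparated G.hom] : IsClosedImmersion (frobKernelι S G).left := by
  haveI := isSeparated_frobTwist_hom S G
  exact isClosedImmersion_kerι_left_of_isSeparated (relFrobenius S G)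

/-- **The underlying points of `Ker F_{G/S}` lie on the unit section of `G`**: for every point `x` of the scheme
`Ker F_{G/S}`, `ι(x) = e_G(s)` for some point `s` of `S` — the relative Frobenius is the identity on points followed
by the projection, and the kernel is the fibre product with the unit. [cite: SGA3I, VII_A 4.1] -/
theorem frobKernelι_left_apply_mem_range (x : (frobKernel S G).left) :
    (frobKernelι S G).left x ∈ Set.range ((η[G] : 𝟙_ (Over S.left) ⟶ G).left : S.left ⟶ G.left) := by
  -- the cartesian square of the kernel, projected to `G`
  have hsq := (isPullback_kerι_left (relFrobenius S G)).w
  have h := congr_arg (fun φ => φ ≫ twistFst S G) hsq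
  simp only [Category.assoc, relFrobenius_left_comp_twistFst, one_twist_left_comp_twistFst] at h
  -- evaluate at `x`: `F_G (ι x) = e_G (F_S (snd x))`, and `F_G`, `F_S` are the identity on points
  have hx := congr_arg (fun φ : (frobKernel S G).left ⟶ G.left => φ x) h
  simp only [Scheme.Hom.comp_apply] at hx
  exact ⟨(frobeniusOver S).left ((pullback.snd (relFrobenius S G) η[frobTwist S G]).left x), hx.symm⟩

end Kernel

end Literature.AlgebraicGeometry.GroupSchemes.RelFrobenius

end
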